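import Literature.Computability.AlgebraicComplexity.ValiantBooleanBridgeBurgisserProofs
import Literature.Computability.AlgebraicComplexity.BurgisserThm45Proofs
import HarnessLib

/-!
# Discharge of pnp.S26 (characteristic zero): `burgisser_collapse_of_VP_eq_VNP_charZero_holds`,
# `PPoly_eq_polyAdvice_NP_of_VP_eq_VNP_holds`

Topic `Literature/Computability/AlgebraicComplexity`; proof-only companion of
`ValiantBooleanBridge.lean` and `ValiantBooleanBridgeBurgisserProofs.lean`. Bürgisser, *Cook's versus
Valiant's hypothesis*, TCS 235 (2000), Cor. 1.2(1), p. 74 (book: *Completeness and Reduction in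
Algebraic Complexity Theory*, Thm. 4.5 / Cor. 4.6(1)): over a field `k` of characteristic zero,
`VP_k = VNP_k` and the generalised Riemann hypothesis (Dedekind form) give
`P/poly = NP/poly = PH/poly`. `ValiantBooleanBridgeBurgisserProofs.lean` reduced both named facts
**pnp.S26** `burgisser_collapse_of_VP_eq_VNP_charZero k` and its circuit form
`PPoly_eq_polyAdvice_NP_of_VP_eq_VNP k` to the single named fact `algebraicSolution_height_bound`
(TCS Thm. 4.5; `burgisser_collapse_of_VP_eq_VNP_charZero_of_heightBound`,
`PPoly_eq_polyAdvice_NP_of_VP_eq_VNP_of_heightBound`), every other step of the printed proof —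
(A2), (A3) modulo Thm. 4.1, Thm. 4.1 from Thm. 4.5 + Rem. 4.6 + Cor. 4.8, Cor. 4.8 from the effective
prime ideal theorem under GRH (discharged: `effectivePrimeIdealTheorem_of_ERH_holds`), Arora–Barak
Thm. 6.18 and the Karp–Lipton-style step `NP ⊆ P/poly ⟹ PH ⊆ P/poly` — being proved in the tree.
Thm. 4.5 is discharged in `BurgisserThm45Proofs.lean` (`algebraicSolution_height_bound_holds`), so
both facts are now theorems. This file contains no definitions.

## References

* P. Bürgisser, *Cook's versus Valiant's hypothesis*, Theoret. Comput. Sci. 235 (2000) 71–88,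
  Thm. 1.1(1) p. 73, Cor. 1.2(1) p. 74 and its proof p. 79, Thm. 4.5 p. 82. [Burgisser2000TCS]
* P. Bürgisser, *Completeness and Reduction in Algebraic Complexity Theory*, Springer 2000,
  Thm. 4.5 and Cor. 4.6(1). [Burgisser2000]
-/

noncomputable section

open Literature.Computability.Complexity Literature.Computability.Complexity.Nondeterministic Literature.Computability.Complexity.Classes

namespace Literature.Computability.AlgebraicComplexity

universe u

variable (k : Type u) [Field k]

/-- **pnp.S26 (characteristic zero) discharged** (Bürgisser 2000 TCS, Cor. 1.2(1), p. 74; book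
Thm. 4.5 / Cor. 4.6(1)): over a field `k` of characteristic zero, `VP_k = VNP_k` and the (Dedekind)
generalised Riemann hypothesis give `polyAdvice P = polyAdvice NP` and `polyAdvice NP = polyAdvice PH`
— the named fact `burgisser_collapse_of_VP_eq_VNP_charZero k` holds. Proof: the tree's reduction to
Thm. 4.5 (`burgisser_collapse_of_VP_eq_VNP_charZero_of_heightBound`) applied to the discharge of
Thm. 4.5 (`algebraicSolution_height_bound_holds`).
[cite: Burgisser2000TCS, Cor. 1.2(1) p. 74] [cite: Burgisser2000, Thm. 4.5 and Cor. 4.6(1)] -/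
theorem burgisser_collapse_of_VP_eq_VNP_charZero_holds :
    burgisser_collapse_of_VP_eq_VNP_charZero k :=
  burgisser_collapse_of_VP_eq_VNP_charZero_of_heightBound k algebraicSolution_height_bound_holds

/-- **`VP_k = VNP_k ⟹ P/poly = NP/poly` (GRH, char. 0) discharged** (Bürgisser 2000 TCS,
Cor. 1.2(1), p. 74; book Cor. 4.6(1)): the named fact `PPoly_eq_polyAdvice_NP_of_VP_eq_VNP k` holds.
Proof: `PPoly_eq_polyAdvice_NP_of_VP_eq_VNP_of_heightBound` applied to
`algebraicSolution_height_bound_holds`.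
[cite: Burgisser2000TCS, Cor. 1.2(1) p. 74] [cite: Burgisser2000, Cor. 4.6(1)] -/
theorem PPoly_eq_polyAdvice_NP_of_VP_eq_VNP_holds :
    PPoly_eq_polyAdvice_NP_of_VP_eq_VNP k :=
  PPoly_eq_polyAdvice_NP_of_VP_eq_VNP_of_heightBound k algebraicSolution_height_bound_holds

/-- The collapse with the conclusion unfolded: over a field of characteristic zero, GRH and
`VP_k = VNP_k` give `polyAdvice P = polyAdvice NP ∧ polyAdvice NP = polyAdvice PH`
(Bürgisser 2000 TCS, Cor. 1.2(1)). [cite: Burgisser2000TCS, Cor. 1.2(1) p. 74] -/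
theorem polyAdvice_collapse_of_VP_eq_VNP [CharZero k]
    (hGRH : Literature.NumberTheory.LFunctions.ExtendedRiemannHypothesis) (h : VP k = VNP k) :
    polyAdvice P = polyAdvice NP ∧ polyAdvice NP = polyAdvice PH :=
  burgisser_collapse_of_VP_eq_VNP_charZero_holds k hGRH h

end Literature.Computability.AlgebraicComplexity

end
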